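import Mathlib
import HarnessLib
import Summits.HubbardSuperconductivity.HubbardSuperconductivity.Theorems.KLProgrammeKLRegimeFlowShellJets

/-!
# Route `KLProgramme`, crux K3 — engine-flow child (stmt-HubbardSuperconductivity-20437), stub (C) `stub_twoLeg_curvature`, (C1) door v2, NEAR part:
# THE TRANSLATE LEMMA WITH LOCAL SIZES — `|∂ʲ[A∘(γ − v)](θ) − ∂ʲ[A∘γ](θ)| ≤ ‖v‖·T_j` from sizes on a convex set containing the segment

Cell gate-hubbard-kl, seat hubbard-kl-k3c3-p3 (g6); `need:` (1) of k3c3-p1 g6 (KL STATUS 2026-08-27T15:20:47Z).  `…KLRegimeFlowShellJets` §1 proved the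
translate lemma with GLOBAL nested sizes `M₁ … M₅` of `F ∈ C⁵`; the near majorant of the along-curve (C1) door (`abs_iteratedDeriv_jhigh1_comp_curve_le_split`,
p542306) applies it to the ANGULAR factor `A` (no cutoff inside) whose sizes are only controlled near the curve.  This file proves the LOCAL form:
`A : V → ℝ` of class `C⁴`, a convex set `S ∋ γθ, γθ − v` (e.g. the closed `r`-ball about `γθ` when `‖v‖ ≤ r`), nested sizes
`‖DA‖ ≤ M₁, …, ‖D⁴A‖ ≤ M₄` ON `S` ONLY, curve jets `‖γ^{(i)}(θ)‖ ≤ D_i`: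
* §1 `norm_fderiv{,_two,_three}_sub_le_of_convex` — `‖DᵏA(x) − DᵏA(y)‖ ≤ M_{k+1}‖x − y‖` for `x, y ∈ S` (mean value on `S`);
* §2 **`abs_comp_translate_sub_le_of_convex`** (order 0, `‖v‖·M₁`), **`abs_iteratedDeriv_{one,two,three}_comp_translate_sub_le_of_convex`** (orders 1–3 WITH the
  gain: `T_j·‖v‖`, `T₁ = M₂D₁`, `T₂ = M₃D₁² + M₂D₂`, `T₃ = M₄D₁³ + 3M₃D₁D₂ + M₂D₃` — stated as `T·‖v‖`, the global twins of `…FlowShellJets` read `‖v‖·T`), and the order-4 NO-GAIN form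
  **`abs_iteratedDeriv_four_comp_translate_sub_le_noGain`** (`≤ 2·Bell₄(M; D)`, `C⁴` only);
* §3 the ball instances `…_of_ball` (`S = closedBall (γ θ) r`, `‖v‖ ≤ r`).
Pure analysis (Faà di Bruno differences of `…PerturbedFermiCurveCompDiff` + the mean value inequality on a convex set); nothing about the model.
[cite: BenfattoGiulianiMastropietro2006, §2.4 (2.36)/(2.40) for the role]
-/

noncomputable section

namespace Summit.HubbardSuperconductivity.HubbardSuperconductivity.Theorems.PerturbedFermiCurve

set_option linter.dupNamespace false -- summit = problem name (single-conjunct summit), D-0017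
set_option maxSynthPendingDepth 4 -- nested operator-norm instances (up to fourth Fréchet derivatives)

open Real Set Metric

/-! ## §1 Mean value on a convex set for the nested derivatives -/

section MeanValue

variable {V : Type*} [NormedAddCommGroup V] [NormedSpace ℝ V] {F : V → ℝ} (hF : ContDiff ℝ 4 F) {S : Set V} (hS : Convex ℝ S)
include hF hS

/-- `‖DA(x) − DA(y)‖ ≤ M₂‖x − y‖` for `x, y ∈ S` from `‖D²A‖ ≤ M₂` on the convex set `S`. [folklore] -/
theorem norm_fderiv_sub_le_of_convex {M₂ : ℝ} (hM₂ : ∀ z ∈ S, ‖fderiv ℝ (fderiv ℝ F) z‖ ≤ M₂) {x y : V} (hx : x ∈ S) (hy : y ∈ S) :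
    ‖fderiv ℝ F x - fderiv ℝ F y‖ ≤ M₂ * ‖x - y‖ :=
  hS.norm_image_sub_le_of_norm_fderiv_le (fun z _ => ((hF.fderiv_right (m := 3) (by norm_num)).differentiable (by norm_num)) z)
    hM₂ hy hx

/-- `‖D²A(x) − D²A(y)‖ ≤ M₃‖x − y‖` for `x, y ∈ S` from `‖D³A‖ ≤ M₃` on `S`. [folklore] -/
theorem norm_fderiv_two_sub_le_of_convex {M₃ : ℝ} (hM₃ : ∀ z ∈ S, ‖fderiv ℝ (fderiv ℝ (fderiv ℝ F)) z‖ ≤ M₃) {x y : V} (hx : x ∈ S) (hy : y ∈ S) :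
    ‖fderiv ℝ (fderiv ℝ F) x - fderiv ℝ (fderiv ℝ F) y‖ ≤ M₃ * ‖x - y‖ :=
  hS.norm_image_sub_le_of_norm_fderiv_le
    (fun z _ => (((hF.fderiv_right (m := 3) (by norm_num)).fderiv_right (m := 2) (by norm_num)).differentiable (by norm_num)) z) hM₃ hy hx

/-- `‖D³A(x) − D³A(y)‖ ≤ M₄‖x − y‖` for `x, y ∈ S` from `‖D⁴A‖ ≤ M₄` on `S`. [folklore] -/
theorem norm_fderiv_three_sub_le_of_convex {M₄ : ℝ} (hM₄ : ∀ z ∈ S, ‖fderiv ℝ (fderiv ℝ (fderiv ℝ (fderiv ℝ F))) z‖ ≤ M₄) {x y : V}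
    (hx : x ∈ S) (hy : y ∈ S) :
    ‖fderiv ℝ (fderiv ℝ (fderiv ℝ F)) x - fderiv ℝ (fderiv ℝ (fderiv ℝ F)) y‖ ≤ M₄ * ‖x - y‖ :=
  hS.norm_image_sub_le_of_norm_fderiv_le
    (fun z _ => ((((hF.fderiv_right (m := 3) (by norm_num)).fderiv_right (m := 2) (by norm_num)).fderiv_right (m := 1) (by norm_num)).differentiable
      (by norm_num)) z) hM₄ hy hx

end MeanValue

/-! ## §2 The translate lemma with sizes on a convex set -/

section Translate

variable {V : Type*} [NormedAddCommGroup V] [NormedSpace ℝ V] {F : V → ℝ} (hF : ContDiff ℝ 4 F) {S : Set V} (hS : Convex ℝ S)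
  {γ : ℝ → V} (hγ : ContDiff ℝ 4 γ) (w : V) {θ : ℝ} (hγS : γ θ ∈ S) (hγwS : γ θ - w ∈ S) {M₁ M₂ M₃ M₄ D₁ D₂ D₃ D₄ : ℝ}
  (hM₁ : ∀ z ∈ S, ‖fderiv ℝ F z‖ ≤ M₁) (hM₂ : ∀ z ∈ S, ‖fderiv ℝ (fderiv ℝ F) z‖ ≤ M₂)
  (hM₃ : ∀ z ∈ S, ‖fderiv ℝ (fderiv ℝ (fderiv ℝ F)) z‖ ≤ M₃) (hM₄ : ∀ z ∈ S, ‖fderiv ℝ (fderiv ℝ (fderiv ℝ (fderiv ℝ F))) z‖ ≤ M₄)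
  (hD₁ : ‖iteratedDeriv 1 γ θ‖ ≤ D₁) (hD₂ : ‖iteratedDeriv 2 γ θ‖ ≤ D₂) (hD₃ : ‖iteratedDeriv 3 γ θ‖ ≤ D₃) (hD₄ : ‖iteratedDeriv 4 γ θ‖ ≤ D₄)

include hF hS hγS hγwS hM₁ in
/-- **Order 0, local**: `|A(γθ − w) − A(γθ)| ≤ M₁‖w‖`. -/
theorem abs_comp_translate_sub_le_of_convex : |F (γ θ - w) - F (γ θ)| ≤ ‖w‖ * M₁ := by
  have h := hS.norm_image_sub_le_of_norm_fderiv_le (𝕜 := ℝ) (f := F) (fun z _ => (hF.differentiable (by norm_num)) z) hM₁ hγS hγwS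
  rw [Real.norm_eq_abs] at h
  refine h.trans (le_of_eq ?_)
  rw [show γ θ - w - γ θ = -w by abel, norm_neg, mul_comm]

include hF hS hγ hγS hγwS hM₁ hM₂ hD₁ in
/-- **Order 1, local**: `|∂(A∘(γ−w))(θ) − ∂(A∘γ)(θ)| ≤ ‖w‖·M₂D₁`. -/
theorem abs_iteratedDeriv_one_comp_translate_sub_le_of_convex :
    |iteratedDeriv 1 (F ∘ fun θ : ℝ => γ θ - w) θ - iteratedDeriv 1 (F ∘ γ) θ| ≤ M₂ * D₁ * ‖w‖ := by
  have hγw := contDiff_translate hγ w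
  have hΦ₁ : ‖fderiv ℝ F (γ θ - w) - fderiv ℝ F (γ θ)‖ ≤ M₂ * ‖w‖ := by
    have h := norm_fderiv_sub_le_of_convex hF hS hM₂ hγwS hγS
    rwa [show γ θ - w - γ θ = -w by abel, norm_neg] at h
  have hD₁' : ‖iteratedDeriv 1 (fun θ : ℝ => γ θ - w) θ‖ ≤ D₁ := by rw [iteratedDeriv_translate hγ w le_rfl (by norm_num)]; exact hD₁
  have hdD₁ : ‖iteratedDeriv 1 (fun θ : ℝ => γ θ - w) θ - iteratedDeriv 1 γ θ‖ ≤ 0 := by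
    rw [iteratedDeriv_translate hγ w le_rfl (by norm_num), sub_self, norm_zero]
  have h := abs_iteratedDeriv_one_comp_sub_le hF hγ hγw (hM₁ _ hγS) hΦ₁ hD₁' hdD₁
  calc _ ≤ M₂ * ‖w‖ * D₁ + M₁ * 0 := h
    _ = M₂ * D₁ * ‖w‖ := by ring

include hF hS hγ hγS hγwS hM₁ hM₂ hM₃ hD₁ hD₂ in
/-- **Order 2, local**: `≤ ‖w‖·(M₃D₁² + M₂D₂)`. -/
theorem abs_iteratedDeriv_two_comp_translate_sub_le_of_convex :
    |iteratedDeriv 2 (F ∘ fun θ : ℝ => γ θ - w) θ - iteratedDeriv 2 (F ∘ γ) θ| ≤ (M₃ * D₁ ^ 2 + M₂ * D₂) * ‖w‖ := by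
  have hγw := contDiff_translate hγ w
  have e0 : γ θ - w - γ θ = -w := by abel
  have hΦ₁ : ‖fderiv ℝ F (γ θ - w) - fderiv ℝ F (γ θ)‖ ≤ M₂ * ‖w‖ := by
    have h := norm_fderiv_sub_le_of_convex hF hS hM₂ hγwS hγS; rwa [e0, norm_neg] at h
  have hΦ₂ : ‖fderiv ℝ (fderiv ℝ F) (γ θ - w) - fderiv ℝ (fderiv ℝ F) (γ θ)‖ ≤ M₃ * ‖w‖ := by
    have h := norm_fderiv_two_sub_le_of_convex hF hS hM₃ hγwS hγS; rwa [e0, norm_neg] at h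
  have hD₁' : ‖iteratedDeriv 1 (fun θ : ℝ => γ θ - w) θ‖ ≤ D₁ := by rw [iteratedDeriv_translate hγ w le_rfl (by norm_num)]; exact hD₁
  have hD₂' : ‖iteratedDeriv 2 (fun θ : ℝ => γ θ - w) θ‖ ≤ D₂ := by rw [iteratedDeriv_translate hγ w (by norm_num) (by norm_num)]; exact hD₂
  have hdD₁ : ‖iteratedDeriv 1 (fun θ : ℝ => γ θ - w) θ - iteratedDeriv 1 γ θ‖ ≤ 0 := by
    rw [iteratedDeriv_translate hγ w le_rfl (by norm_num), sub_self, norm_zero]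
  have hdD₂ : ‖iteratedDeriv 2 (fun θ : ℝ => γ θ - w) θ - iteratedDeriv 2 γ θ‖ ≤ 0 := by
    rw [iteratedDeriv_translate hγ w (by norm_num) (by norm_num), sub_self, norm_zero]
  have h := abs_iteratedDeriv_two_comp_sub_le hF hγ hγw (hM₁ _ hγS) (hM₂ _ hγS) hΦ₁ hΦ₂ hD₁ hD₁' hD₂' hdD₁ hdD₂
  calc _ ≤ M₃ * ‖w‖ * D₁ ^ 2 + 2 * M₂ * D₁ * 0 + M₂ * ‖w‖ * D₂ + M₁ * 0 := h
    _ = (M₃ * D₁ ^ 2 + M₂ * D₂) * ‖w‖ := by ring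

include hF hS hγ hγS hγwS hM₁ hM₂ hM₃ hM₄ hD₁ hD₂ hD₃ in
/-- **Order 3, local**: `≤ ‖w‖·(M₄D₁³ + 3M₃D₁D₂ + M₂D₃)`. -/
theorem abs_iteratedDeriv_three_comp_translate_sub_le_of_convex :
    |iteratedDeriv 3 (F ∘ fun θ : ℝ => γ θ - w) θ - iteratedDeriv 3 (F ∘ γ) θ| ≤
      (M₄ * D₁ ^ 3 + 3 * M₃ * D₁ * D₂ + M₂ * D₃) * ‖w‖ := by
  have hγw := contDiff_translate hγ w
  have e0 : γ θ - w - γ θ = -w := by abel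
  have hΦ₁ : ‖fderiv ℝ F (γ θ - w) - fderiv ℝ F (γ θ)‖ ≤ M₂ * ‖w‖ := by
    have h := norm_fderiv_sub_le_of_convex hF hS hM₂ hγwS hγS; rwa [e0, norm_neg] at h
  have hΦ₂ : ‖fderiv ℝ (fderiv ℝ F) (γ θ - w) - fderiv ℝ (fderiv ℝ F) (γ θ)‖ ≤ M₃ * ‖w‖ := by
    have h := norm_fderiv_two_sub_le_of_convex hF hS hM₃ hγwS hγS; rwa [e0, norm_neg] at h
  have hΦ₃ : ‖fderiv ℝ (fderiv ℝ (fderiv ℝ F)) (γ θ - w) - fderiv ℝ (fderiv ℝ (fderiv ℝ F)) (γ θ)‖ ≤ M₄ * ‖w‖ := by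
    have h := norm_fderiv_three_sub_le_of_convex hF hS hM₄ hγwS hγS; rwa [e0, norm_neg] at h
  have hD₁' : ‖iteratedDeriv 1 (fun θ : ℝ => γ θ - w) θ‖ ≤ D₁ := by
    rw [iteratedDeriv_translate hγ w le_rfl (by norm_num)]; exact hD₁
  have hD₂' : ‖iteratedDeriv 2 (fun θ : ℝ => γ θ - w) θ‖ ≤ D₂ := by
    rw [iteratedDeriv_translate hγ w (by norm_num) (by norm_num)]; exact hD₂
  have hD₃' : ‖iteratedDeriv 3 (fun θ : ℝ => γ θ - w) θ‖ ≤ D₃ := by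
    rw [iteratedDeriv_translate hγ w (by norm_num) (by norm_num)]; exact hD₃
  have hdD₁ : ‖iteratedDeriv 1 (fun θ : ℝ => γ θ - w) θ - iteratedDeriv 1 γ θ‖ ≤ 0 := by
    rw [iteratedDeriv_translate hγ w le_rfl (by norm_num), sub_self, norm_zero]
  have hdD₂ : ‖iteratedDeriv 2 (fun θ : ℝ => γ θ - w) θ - iteratedDeriv 2 γ θ‖ ≤ 0 := by
    rw [iteratedDeriv_translate hγ w (by norm_num) (by norm_num), sub_self, norm_zero]
  have hdD₃ : ‖iteratedDeriv 3 (fun θ : ℝ => γ θ - w) θ - iteratedDeriv 3 γ θ‖ ≤ 0 := by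
    rw [iteratedDeriv_translate hγ w (by norm_num) (by norm_num), sub_self, norm_zero]
  have h := abs_iteratedDeriv_three_comp_sub_le hF hγ hγw (hM₁ _ hγS) (hM₂ _ hγS) (hM₃ _ hγS) hΦ₁ hΦ₂ hΦ₃ hD₁ hD₁' hD₂ hD₂'
    hD₃' hdD₁ hdD₂ hdD₃
  calc _ ≤ M₄ * ‖w‖ * D₁ ^ 3 + 3 * M₃ * 0 * D₁ ^ 2 + 3 * (M₃ * ‖w‖ * D₁ * D₂ + M₂ * (0 * D₂ + D₁ * 0)) + M₂ * ‖w‖ * D₃ + M₁ * 0 := h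
    _ = (M₄ * D₁ ^ 3 + 3 * M₃ * D₁ * D₂ + M₂ * D₃) * ‖w‖ := by ring

include hF hγ hγS hγwS hM₁ hM₂ hM₃ hM₄ hD₁ hD₂ hD₃ hD₄ in
/-- **Order 4, NO gain** (`A ∈ C⁴` only): `|∂⁴(A∘(γ−w))(θ) − ∂⁴(A∘γ)(θ)| ≤ 2·(M₄D₁⁴ + 6M₃D₁²D₂ + 3M₂D₂² + 4M₂D₁D₃ + M₁D₄)` (triangle: both
points lie in `S`). -/
theorem abs_iteratedDeriv_four_comp_translate_sub_le_noGain :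
    |iteratedDeriv 4 (F ∘ fun θ : ℝ => γ θ - w) θ - iteratedDeriv 4 (F ∘ γ) θ| ≤
      2 * (M₄ * D₁ ^ 4 + 6 * M₃ * D₁ ^ 2 * D₂ + 3 * M₂ * D₂ ^ 2 + 4 * M₂ * D₁ * D₃ + M₁ * D₄) := by
  have hγw := contDiff_translate hγ w
  -- sizes in `iteratedFDeriv` currency at the two points
  have c1 : ∀ z ∈ S, ‖iteratedFDeriv ℝ 1 F z‖ ≤ M₁ := fun z hz => by rw [← norm_fderiv_eq_norm_iteratedFDeriv_one]; exact hM₁ z hz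
  have c2 : ∀ z ∈ S, ‖iteratedFDeriv ℝ 2 F z‖ ≤ M₂ := fun z hz => by rw [← norm_fderiv_two_eq_norm_iteratedFDeriv]; exact hM₂ z hz
  have c3 : ∀ z ∈ S, ‖iteratedFDeriv ℝ 3 F z‖ ≤ M₃ := fun z hz => by rw [← norm_fderiv_three_eq_norm_iteratedFDeriv]; exact hM₃ z hz
  have c4 : ∀ z ∈ S, ‖iteratedFDeriv ℝ 4 F z‖ ≤ M₄ := fun z hz => by rw [← norm_fderiv_four_eq_norm_iteratedFDeriv]; exact hM₄ z hz
  have hD₁' : ‖iteratedDeriv 1 (fun θ : ℝ => γ θ - w) θ‖ ≤ D₁ := by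
    rw [iteratedDeriv_translate hγ w le_rfl (by norm_num)]; exact hD₁
  have hD₂' : ‖iteratedDeriv 2 (fun θ : ℝ => γ θ - w) θ‖ ≤ D₂ := by
    rw [iteratedDeriv_translate hγ w (by norm_num) (by norm_num)]; exact hD₂
  have hD₃' : ‖iteratedDeriv 3 (fun θ : ℝ => γ θ - w) θ‖ ≤ D₃ := by
    rw [iteratedDeriv_translate hγ w (by norm_num) (by norm_num)]; exact hD₃
  have hD₄' : ‖iteratedDeriv 4 (fun θ : ℝ => γ θ - w) θ‖ ≤ D₄ := by
    rw [iteratedDeriv_translate hγ w (by norm_num) (by norm_num)]; exact hD₄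
  have hγwθ : (fun θ : ℝ => γ θ - w) θ ∈ S := hγwS
  have h1 := abs_iteratedDeriv_four_comp_le_struct hF hγw (c1 _ hγwθ) (c2 _ hγwθ) (c3 _ hγwθ) (c4 _ hγwθ) hD₁' hD₂' hD₃' hD₄'
  have h0 := abs_iteratedDeriv_four_comp_le_struct hF hγ (c1 _ hγS) (c2 _ hγS) (c3 _ hγS) (c4 _ hγS) hD₁ hD₂ hD₃ hD₄
  have tri := abs_sub _ _ |>.trans (add_le_add h1 h0)
  linarith

end Translate

/-! ## §3 The ball instances (`S = closedBall (γ θ) r`, `‖w‖ ≤ r`) -/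

section Ball

variable {V : Type*} [NormedAddCommGroup V] [NormedSpace ℝ V] {F : V → ℝ} (hF : ContDiff ℝ 4 F)
  {γ : ℝ → V} (hγ : ContDiff ℝ 4 γ) {w : V} {θ r : ℝ} (hw : ‖w‖ ≤ r) {M₁ M₂ M₃ M₄ D₁ D₂ D₃ D₄ : ℝ}
  (hM₁ : ∀ z, ‖z - γ θ‖ ≤ r → ‖fderiv ℝ F z‖ ≤ M₁) (hM₂ : ∀ z, ‖z - γ θ‖ ≤ r → ‖fderiv ℝ (fderiv ℝ F) z‖ ≤ M₂)
  (hM₃ : ∀ z, ‖z - γ θ‖ ≤ r → ‖fderiv ℝ (fderiv ℝ (fderiv ℝ F)) z‖ ≤ M₃)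
  (hM₄ : ∀ z, ‖z - γ θ‖ ≤ r → ‖fderiv ℝ (fderiv ℝ (fderiv ℝ (fderiv ℝ F))) z‖ ≤ M₄)
  (hD₁ : ‖iteratedDeriv 1 γ θ‖ ≤ D₁) (hD₂ : ‖iteratedDeriv 2 γ θ‖ ≤ D₂) (hD₃ : ‖iteratedDeriv 3 γ θ‖ ≤ D₃) (hD₄ : ‖iteratedDeriv 4 γ θ‖ ≤ D₄)

omit [NormedSpace ℝ V] hF hγ in
include hw in
/-- The two points of the segment lie in the closed `r`-ball about `γ θ`. -/
theorem translate_mem_closedBall : γ θ ∈ closedBall (γ θ) r ∧ γ θ - w ∈ closedBall (γ θ) r := by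
  have hr : 0 ≤ r := (norm_nonneg _).trans hw
  refine ⟨mem_closedBall_self hr, ?_⟩
  rw [mem_closedBall, dist_eq_norm, show γ θ - w - γ θ = -w by abel, norm_neg]; exact hw

include hF hγ hw hM₁ hM₂ hM₃ hM₄ hD₁ hD₂ hD₃ hD₄ in
/-- **The translate lemma on the `r`-ball** (all orders at once): orders 0–3 with the gain `‖w‖`, order 4 without. -/
theorem abs_iteratedDeriv_comp_translate_sub_le_of_ball :
    |F (γ θ - w) - F (γ θ)| ≤ ‖w‖ * M₁ ∧
    |iteratedDeriv 1 (F ∘ fun θ : ℝ => γ θ - w) θ - iteratedDeriv 1 (F ∘ γ) θ| ≤ M₂ * D₁ * ‖w‖ ∧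
    |iteratedDeriv 2 (F ∘ fun θ : ℝ => γ θ - w) θ - iteratedDeriv 2 (F ∘ γ) θ| ≤ (M₃ * D₁ ^ 2 + M₂ * D₂) * ‖w‖ ∧
    |iteratedDeriv 3 (F ∘ fun θ : ℝ => γ θ - w) θ - iteratedDeriv 3 (F ∘ γ) θ| ≤ (M₄ * D₁ ^ 3 + 3 * M₃ * D₁ * D₂ + M₂ * D₃) * ‖w‖ ∧
    |iteratedDeriv 4 (F ∘ fun θ : ℝ => γ θ - w) θ - iteratedDeriv 4 (F ∘ γ) θ| ≤
      2 * (M₄ * D₁ ^ 4 + 6 * M₃ * D₁ ^ 2 * D₂ + 3 * M₂ * D₂ ^ 2 + 4 * M₂ * D₁ * D₃ + M₁ * D₄) := by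
  have hS : Convex ℝ (closedBall (γ θ) r) := convex_closedBall _ _
  obtain ⟨h0S, hwS⟩ := translate_mem_closedBall (γ := γ) hw
  have e : ∀ z : V, z ∈ closedBall (γ θ) r ↔ ‖z - γ θ‖ ≤ r := fun z => by rw [mem_closedBall, dist_eq_norm]
  have m1 : ∀ z ∈ closedBall (γ θ) r, ‖fderiv ℝ F z‖ ≤ M₁ := fun z hz => hM₁ z ((e z).1 hz)
  have m2 : ∀ z ∈ closedBall (γ θ) r, ‖fderiv ℝ (fderiv ℝ F) z‖ ≤ M₂ := fun z hz => hM₂ z ((e z).1 hz)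
  have m3 : ∀ z ∈ closedBall (γ θ) r, ‖fderiv ℝ (fderiv ℝ (fderiv ℝ F)) z‖ ≤ M₃ := fun z hz => hM₃ z ((e z).1 hz)
  have m4 : ∀ z ∈ closedBall (γ θ) r, ‖fderiv ℝ (fderiv ℝ (fderiv ℝ (fderiv ℝ F))) z‖ ≤ M₄ := fun z hz => hM₄ z ((e z).1 hz)
  exact ⟨abs_comp_translate_sub_le_of_convex hF hS w h0S hwS m1,
    abs_iteratedDeriv_one_comp_translate_sub_le_of_convex hF hS hγ w h0S hwS m1 m2 hD₁,
    abs_iteratedDeriv_two_comp_translate_sub_le_of_convex hF hS hγ w h0S hwS m1 m2 m3 hD₁ hD₂,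
    abs_iteratedDeriv_three_comp_translate_sub_le_of_convex hF hS hγ w h0S hwS m1 m2 m3 m4 hD₁ hD₂ hD₃,
    abs_iteratedDeriv_four_comp_translate_sub_le_noGain hF hγ w h0S hwS m1 m2 m3 m4 hD₁ hD₂ hD₃ hD₄⟩

end Ball

end Summit.HubbardSuperconductivity.HubbardSuperconductivity.Theorems.PerturbedFermiCurve

end
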